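import Summits.BirchSwinnertonDyer.BirchSwinnertonDyer.Theorems.EisensteinPrimesAnalyticLambdaCalculus
import Summits.BirchSwinnertonDyer.BirchSwinnertonDyer.Theorems.EisensteinPrimesX2AlgebraicLambdaGESplitTorsion
import Summits.BirchSwinnertonDyer.Rank1Residual.Iwasawa.LambdaInvariantValuationTwisted
import Summits.BirchSwinnertonDyer.Rank1Residual.Iwasawa.LambdaInvariantTwistedNonvanishing
import Summits.BirchSwinnertonDyer.Rank1Residual.X2.RankOneHeegnerExact
import HarnessLib

/-!
# Route `EisensteinPrimes`, line `mudescent`, stub `stub_lambdaCount_offLocus` (X2, crux 3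
# `MazurMCOnCellB`): the ANALYTIC inputs of the stub AT A PAIR from ONE finite certificate, and the
# END-TO-END per-pair main-conjecture certificate at a type-A split étale end (helper; closes nothing)

Seat `bsd-eis-lam-a` g3 (PROGRAMME PART 1b, ACCEL-LIST (4): "ANALYTIC side of
`stub_lambdaCount_offLocus`"; items stmt-BirchSwinnertonDyer-19033 / -19035; skeleton owner
bsd-eis-ky, `Lines/mudescent.lean`). Sequel of g0's `EisensteinPrimesAnalyticLambdaCalculus`
(`∃ n, X2.AnalyticLambdaEq W p n` unconditionally — but WITHOUT the value of `n`) and of lam-b g2's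
`EisensteinPrimesX2AlgebraicLambdaGESplitTorsion` (the algebraic conjunct at a type-A split étale end
from integer data, GIVEN `X2.AnalyticMuLE W p m` "in lam-a currency").

HONEST FRAMING. THEOREMS ONLY — no definition, no new named fact; nothing about any particular
curve is asserted; closes nothing; moves no label. The comparison `n ≤ k + e` of the stub needs the
VALUE `n = λ_an(W₀, p)`, i.e. a per-pair certificate. The tree certifies `(μ, λ)` of an element of
`Λ` from finitely many data in two currencies — a UNIT COEFFICIENT of `ϖ·L_p` (iw-1's
`Iwasawa.UnitCoeffAt`, Riemann sums `Iwasawa.unitCoeffAt_of_riemannSumUnitCertAt`) and ONE BIRCH SUM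
`ϖ·∑_a χ(a)[a/p^k]⁺_f` of valuation `< 1` (`Iwasawa.mu_eq_zero_and_lam_eq_of_norm_twist_pow_eq`) —
but no theorem so far turns either into the skeleton's typed analytic inputs
`X2.AnalyticMuLE W₀ p 0 ∧ X2.AnalyticLambdaEq W₀ p n` at an ODD multiplicative prime (the only
producer of an `X2.AnalyticLambdaEq` with a value is `analyticLambdaEq_of_coeffUnitCert`, `p = 2`).
This file is that bridge, and its composition with route T and lam-b's budget:

* §1 `datum_unique`, `analyticMuLE_iff_of_datum`, `analyticLambdaEq_iff_of_datum` — ALL admissible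
  data `(f, ϖ, L)` of `X2.AnalyticMuLE` / `X2.AnalyticLambdaEq` at `(W, p)` COINCIDE (strong
  multiplicity one across levels `IsNewformOf.level_eq_level` / `.unique`, uniqueness of THE
  Mazur–Tate–Teitelbaum function `padicL_eq_of_isIsogenous`, `Ω_W ≠ 0`), so both typed `∀`-statements
  may be read on any one datum.
* §2 certificates ⇒ typed inputs: a unit coefficient of index `m` of `ϖ·L` gives
  `AnalyticMuLE W p 0` and `∃ n ≤ m, AnalyticLambdaEq W p n` (`…_of_norm_coeff_eq_one`); the FIRST
  unit coefficient at index `n` gives `AnalyticLambdaEq W p n` (`…_of_firstUnitCoeff`); iw-1's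
  `UnitCoeffAt W p m` gives `AnalyticMuLE W p 0 ∧ ∃ n, AnalyticLambdaEq W p n ∧ (¬split → n ≤ m) ∧
  (split → n ≤ m + 1)` (`…_of_unitCoeffAt`); ONE Birch sum with
  `|ϖ·∑_a χ(a)[a/p^{n+1+e₀}]⁺_f|^{φ(pⁿ⁺¹)} = p^{−V}`, `V < φ(pⁿ⁺¹)`, gives
  `AnalyticMuLE W p 0 ∧ AnalyticLambdaEq W p V` (`…_of_norm_twist_pow_eq`); and a VANISHING Birch
  sum at conductor `p^{n+1+e₀}` (a vanishing twist `L(E, χ, 1) = 0` of order `pⁿ⁺¹`) forces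
  `φ(pⁿ⁺¹) ≤ n'` for the certified `λ_an = n'` (`totient_le_of_analyticLambdaEq_of_twist_eq_zero`) —
  the kernel face of MEMO-2 §4b: every "torsion-point zero" of `L_p(E₀,T)` (numerically: a rank jump
  of `E₀` in the layer `ℚ_{n+1}`) costs `φ(pⁿ⁺¹)` units of `λ_an` that stub 4 must match by
  `AlgebraicLambdaGE` (lam-b's `algebraicLambdaGE_of_layerRankGEAt`, Greenberg Thm. 1.9).
* §3 stubs 3 + 4 AT A PAIR from certificates: `UnitCoeffAt W₀ p m`, `AlgebraicLambdaGE W₀ p k`,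
  `m ≤ k` ⇒ the registered conclusion of `stub_lambdaCount_offLocus` at `W₀` verbatim AND
  `X2.AnalyticMuLE W₀ p 0` (`lambdaCount_of_unitCoeffAt_of_algebraicLambdaGE`); with Wuthrich 2014
  Thm. 16 (`hWu`), Mazur's main conjecture at the pair (`mazurMainConjectureAt_of_unitCoeffAt_of_algebraicLambdaGE`,
  route T `X2.mazurMainConjectureAt_of_algebraicLambdaGE`).
* §4 END-TO-END at a type-A SPLIT ÉTALE END (`p` odd multiplicative, `p ∣ #E(ℚ)_tors`, so split and
  `E[p]` reducible): `UnitCoeffAt W₀ p m` + `S` places `v ∤ p` with `p ∣ c_v(W₀)` +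
  `m + 2·v_p(#E(ℚ)_tors) ≤ #S + 1` ⇒ `X2.MazurMainConjectureAt W₀ p`
  (`X2.mazurMainConjectureAt_of_unitCoeffAt_of_dvd_torsionOrder_of_dvd_localTamagawaNumber`), named
  facts exactly lam-b's (`hPT`, `h415`, `hWu`, `hpar`); and at every ℚ-isogenous member in analytic
  rank `0` (`…_of_isIsogenous`, the ASCEND step of `MazurMCOnCellB_of` with its PublishedInputs
  conjuncts). This is lam-b g2's HANDOFF list "WHAT A CERTIFICATE NOW NEEDS (per pair, X2b, layer 0)"
  with its analytic item supplied: per pair, ONE unit-coefficient index and two integers.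

References: [GreenbergVatsal2000] (1)–(2), p. 28; [MazurTateTeitelbaum1986Invent] §I.10, §I.13–I.14;
[Washington1997] §7.1–7.2; [GreenbergLNM1716] §5 pp. 114–118, Cor. 5.6 (p. 136); [Wuthrich2014]
Thm. 16; HOME/lam-a-g2/lam-a-MEMO-2.md §4b; HOME/HANDOFF.md § bsd-eis-lam-b g2.
-/

set_option linter.dupNamespace false
set_option autoImplicit false

noncomputable section

open scoped Classical MatrixGroups ModularForm

open PowerSeries CongruenceSubgroup WeierstrassCurve NumberField IsDedekindDomain
  Literature.NumberTheory.EllipticCurves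
  Literature.NumberTheory.EllipticCurves.ModularForms
  Literature.NumberTheory.EllipticCurves.Rank1Residual
  Literature.NumberTheory.EllipticCurves.GreenbergVatsal2000
  Literature.NumberTheory.GaloisCohomology
  Summit.BirchSwinnertonDyer.Rank1Residual
  Summit.BirchSwinnertonDyer.Rank1Residual.X1.MuLambda
  Summit.BirchSwinnertonDyer.Rank1Residual.X1.TamagawaSqueeze
  Summit.BirchSwinnertonDyer.Rank1Residual.X11a
  Summit.BirchSwinnertonDyer.Rank1Residual.X11a.LambdaNorm
  Summit.BirchSwinnertonDyer.Rank1Residual.Iwasawa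
  Summit.BirchSwinnertonDyer.BirchSwinnertonDyer.Theorems.EisensteinPrimesAnalyticLambdaCalculus
  Summit.BirchSwinnertonDyer.BirchSwinnertonDyer.Theorems.EisensteinPrimesX2AlgebraicLambdaGESplitTorsion

namespace Summit.BirchSwinnertonDyer.BirchSwinnertonDyer.Theorems.EisensteinPrimesX2AnalyticLambdaCertificate

variable {W : WeierstrassCurve ℚ} [W.IsElliptic] [W.IsGloballyMinimal] {p : ℕ} [Fact p.Prime]

/-! ## §1. All admissible data coincide: the typed invariants read on one datum -/

section Datum

variable {N : ℕ} [NeZero N] {f : CuspForm (Gamma0 N) 2} {ϖ : ℚ} {L : PowerSeries ℚ_[p]}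

omit [W.IsGloballyMinimal] in
/-- **Admissible data are unique.** Two data `(f, ϖ, L)`, `(f', ϖ', L')` of `X2.AnalyticMuLE` /
`X2.AnalyticLambdaEq` at `(W, p)` (newform of `W` at any level, `ϖ·Ω_W = Ω⁺_f`, THE multiplicative
Mazur–Tate–Teitelbaum function read through the split/non-split dichotomy) have `ϖ' = ϖ` and
`L' = L`: the newform is unique across levels (Atkin–Lehner), hence so is `Ω⁺_f`, `Ω_W ≠ 0`, and THE
MTT function is unique (`padicL_eq_of_isIsogenous` on `W ∼ W`). [cite: AtkinLehner1970, Thm. 4]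
[cite: MazurTateTeitelbaum1986Invent, §I.14 (14.3)] -/
theorem datum_unique (hf : IsNewformOf W f) (hϖ : (ϖ : ℝ) * W.realPeriodRat = plusPeriod f)
    (hLs : W.HasSplitMultiplicativeReductionAtPrime p → IsSplitMultPAdicLFunctionOf f p L)
    (hLn : ¬ W.HasSplitMultiplicativeReductionAtPrime p → IsMultPAdicLFunctionOf f p (-1) L)
    {N' : ℕ} [NeZero N'] {f' : CuspForm (Gamma0 N') 2} (hf' : IsNewformOf W f')
    {ϖ' : ℚ} (hϖ' : (ϖ' : ℝ) * W.realPeriodRat = plusPeriod f') {L' : PowerSeries ℚ_[p]}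
    (hLs' : W.HasSplitMultiplicativeReductionAtPrime p → IsSplitMultPAdicLFunctionOf f' p L')
    (hLn' : ¬ W.HasSplitMultiplicativeReductionAtPrime p → IsMultPAdicLFunctionOf f' p (-1) L') :
    ϖ' = ϖ ∧ L' = L := by
  have hLL : L = L' :=
    padicL_eq_of_isIsogenous (IsIsogenous.refl_holds (W := W)) hf hf' hLs hLn hLs' hLn'
  obtain rfl : N = N' := hf.level_eq_level hf'
  obtain rfl : f = f' := hf.unique hf'
  obtain ⟨-, hΩ⟩ := varpi_ne_zero_and_realPeriodRat_ne_zero hf hϖ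
  refine ⟨?_, hLL.symm⟩
  have h : (ϖ' : ℝ) * W.realPeriodRat = (ϖ : ℝ) * W.realPeriodRat := by rw [hϖ', hϖ]
  exact_mod_cast mul_right_cancel₀ hΩ h

/-- **`X2.AnalyticMuLE W p m` read on one datum**: it says that SOME coefficient of `ϖ·L` has norm
`> p^{-(m+1)}`. [cite: GreenbergVatsal2000, p. 2, (2)] -/
theorem analyticMuLE_iff_of_datum (hf : IsNewformOf W f)
    (hϖ : (ϖ : ℝ) * W.realPeriodRat = plusPeriod f)
    (hLs : W.HasSplitMultiplicativeReductionAtPrime p → IsSplitMultPAdicLFunctionOf f p L)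
    (hLn : ¬ W.HasSplitMultiplicativeReductionAtPrime p → IsMultPAdicLFunctionOf f p (-1) L)
    (m : ℕ) :
    X2.AnalyticMuLE W p m ↔ ∃ k : ℕ, (p : ℝ) ^ (-((m : ℤ) + 1)) <
      ‖PowerSeries.coeff k (PowerSeries.C ((ϖ : ℚ) : ℚ_[p]) * L)‖ := by
  refine ⟨fun h ↦ h f hf ϖ hϖ L hLs hLn, fun h ↦ ?_⟩
  intro N' _ f' hf' ϖ' hϖ' L' hLs' hLn'
  obtain ⟨rfl, rfl⟩ := datum_unique hf hϖ hLs hLn hf' hϖ' hLs' hLn'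
  exact h

/-- **`X2.AnalyticLambdaEq W p n` read on one datum**: every integral model `G ∈ Λ` of `ϖ·L`
(`ι G = ϖ·L`; unique by injectivity of `ι`) has `λ(G) = n`. [cite: GreenbergVatsal2000, p. 2–3, (1)–(2)] -/
theorem analyticLambdaEq_iff_of_datum (hf : IsNewformOf W f)
    (hϖ : (ϖ : ℝ) * W.realPeriodRat = plusPeriod f)
    (hLs : W.HasSplitMultiplicativeReductionAtPrime p → IsSplitMultPAdicLFunctionOf f p L)
    (hLn : ¬ W.HasSplitMultiplicativeReductionAtPrime p → IsMultPAdicLFunctionOf f p (-1) L)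
    (n : ℕ) :
    X2.AnalyticLambdaEq W p n ↔ ∀ G : IwasawaAlgebra p,
      iwasawaToPowerSeries p G = PowerSeries.C ((ϖ : ℚ) : ℚ_[p]) * L → lam G = n := by
  refine ⟨fun h G hG ↦ h f hf ϖ hϖ L hLs hLn G hG, fun h ↦ ?_⟩
  intro N' _ f' hf' ϖ' hϖ' L' hLs' hLn' G' hG'
  obtain ⟨rfl, rfl⟩ := datum_unique hf hϖ hLs hLn hf' hϖ' hLs' hLn'
  exact h G' hG'

end Datum

/-! ## §2. Certificates ⇒ the typed analytic inputs -/

section Certificates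

variable {N : ℕ} [NeZero N] {f : CuspForm (Gamma0 N) 2} {ϖ : ℚ} {L : PowerSeries ℚ_[p]}

/-- The norms of the coefficients of an integral model are those of `ϖ·L`. [folklore] -/
theorem norm_coeff_eq_of_iota_eq {G : IwasawaAlgebra p} {F : PowerSeries ℚ_[p]}
    (hG : iwasawaToPowerSeries p G = F) (j : ℕ) :
    ‖PowerSeries.coeff j G‖ = ‖PowerSeries.coeff j F‖ := by
  rw [← hG, iwasawaToPowerSeries, PowerSeries.coeff_map]
  simp

/-- **A UNIT COEFFICIENT gives `μ_an = 0`**: `‖[T^m](ϖ·L)‖ = 1` for one datum ⇒ `X2.AnalyticMuLE W p 0`.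
[cite: GreenbergVatsal2000, p. 2, (2)] -/
theorem analyticMuLE_zero_of_norm_coeff_eq_one (hf : IsNewformOf W f)
    (hϖ : (ϖ : ℝ) * W.realPeriodRat = plusPeriod f)
    (hLs : W.HasSplitMultiplicativeReductionAtPrime p → IsSplitMultPAdicLFunctionOf f p L)
    (hLn : ¬ W.HasSplitMultiplicativeReductionAtPrime p → IsMultPAdicLFunctionOf f p (-1) L)
    {m : ℕ} (hm : ‖PowerSeries.coeff m (PowerSeries.C ((ϖ : ℚ) : ℚ_[p]) * L)‖ = 1) :
    X2.AnalyticMuLE W p 0 := by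
  refine (analyticMuLE_iff_of_datum hf hϖ hLs hLn 0).mpr ⟨m, ?_⟩
  rw [hm]
  have hp1 : (1 : ℝ) < p := by exact_mod_cast (Fact.out : p.Prime).one_lt
  have : (p : ℝ) ^ (-(((0 : ℕ) : ℤ) + 1)) = (p : ℝ)⁻¹ := by simp
  rw [this]
  exact inv_lt_one_of_one_lt₀ hp1

/-- **A unit coefficient of index `m` gives `λ_an ≤ m`**: `∃ n ≤ m, X2.AnalyticLambdaEq W p n`
(`λ` = least index of a unit coefficient of the integral model; vacuous `n = 0` if `ϖ·L ∉ Λ`).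
[cite: GreenbergVatsal2000, p. 2–3, (1)–(2)] [cite: Washington1997, §7.1] -/
theorem exists_analyticLambdaEq_le_of_norm_coeff_eq_one (hf : IsNewformOf W f)
    (hϖ : (ϖ : ℝ) * W.realPeriodRat = plusPeriod f)
    (hLs : W.HasSplitMultiplicativeReductionAtPrime p → IsSplitMultPAdicLFunctionOf f p L)
    (hLn : ¬ W.HasSplitMultiplicativeReductionAtPrime p → IsMultPAdicLFunctionOf f p (-1) L)
    {m : ℕ} (hm : ‖PowerSeries.coeff m (PowerSeries.C ((ϖ : ℚ) : ℚ_[p]) * L)‖ = 1) :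
    ∃ n ≤ m, X2.AnalyticLambdaEq W p n := by
  by_cases hex : ∃ G : IwasawaAlgebra p,
      iwasawaToPowerSeries p G = PowerSeries.C ((ϖ : ℚ) : ℚ_[p]) * L
  · obtain ⟨G, hG⟩ := hex
    obtain ⟨-, -, hle⟩ := lam_le_of_norm_coeff_iota_eq_one hG hm
    refine ⟨lam G, hle, (analyticLambdaEq_iff_of_datum hf hϖ hLs hLn _).mpr fun G' hG' ↦ ?_⟩
    rw [iwasawaToPowerSeries_injective p (hG'.trans hG.symm)]
  · exact ⟨0, Nat.zero_le _, (analyticLambdaEq_iff_of_datum hf hϖ hLs hLn _).mpr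
      fun G' hG' ↦ absurd ⟨G', hG'⟩ hex⟩

/-- **The FIRST unit coefficient gives `λ_an` exactly**: `‖[T^j](ϖ·L)‖ < 1` for `j < n` and
`‖[T^n](ϖ·L)‖ = 1` for one datum ⇒ `X2.AnalyticMuLE W p 0 ∧ X2.AnalyticLambdaEq W p n` (Weierstrass
degree = `ord_T` of the reduction mod `p`; tree `lam_eq_normLam`, `normLam_eq_iff`). This is the
shape of the census's two-engine `(μ, Λ)_an` certificate, now a producer of the skeleton's inputs.
[cite: Washington1997, §7.1 (Prop. 7.2, Thm. 7.3)] [cite: GreenbergVatsal2000, p. 2–3, (1)–(2)] -/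
theorem analyticMuLE_zero_and_analyticLambdaEq_of_firstUnitCoeff (hf : IsNewformOf W f)
    (hϖ : (ϖ : ℝ) * W.realPeriodRat = plusPeriod f)
    (hLs : W.HasSplitMultiplicativeReductionAtPrime p → IsSplitMultPAdicLFunctionOf f p L)
    (hLn : ¬ W.HasSplitMultiplicativeReductionAtPrime p → IsMultPAdicLFunctionOf f p (-1) L)
    {n : ℕ} (hlow : ∀ j < n, ‖PowerSeries.coeff j (PowerSeries.C ((ϖ : ℚ) : ℚ_[p]) * L)‖ < 1)
    (hn : ‖PowerSeries.coeff n (PowerSeries.C ((ϖ : ℚ) : ℚ_[p]) * L)‖ = 1) :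
    X2.AnalyticMuLE W p 0 ∧ X2.AnalyticLambdaEq W p n := by
  refine ⟨analyticMuLE_zero_of_norm_coeff_eq_one hf hϖ hLs hLn hn,
    (analyticLambdaEq_iff_of_datum hf hϖ hLs hLn n).mpr fun G hG ↦ ?_⟩
  have hcoe := norm_coeff_eq_of_iota_eq hG
  have hGn : ‖PowerSeries.coeff n G‖ = 1 := by rw [hcoe]; exact hn
  have hex : ∃ k, ‖PowerSeries.coeff k G‖ = 1 := ⟨n, hGn⟩
  have hunit : HasUnitContent G := (hasUnitContent_iff_exists_norm_eq_one G).mpr hex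
  rw [lam_eq_normLam hunit, normLam_eq_iff (hasMaxCoeff_of_exists_norm_eq_one hex) n]
  refine ⟨isMaxCoeffAt_of_norm_eq_one hGn, fun j hj ↦ ?_⟩
  rw [hGn, hcoe]
  exact hlow j hj

/-- **iw-1's census currency `UnitCoeffAt W p m`** (the coefficient of index `m`, resp. `m + 1` at a
split prime, of `ϖ·L_p` is a unit, for every newform and `ϖ`) **gives the skeleton's analytic inputs**:
`X2.AnalyticMuLE W p 0` and `∃ n, X2.AnalyticLambdaEq W p n ∧ (¬split → n ≤ m) ∧ (split → n ≤ m + 1)`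
— the split shift is the trivial zero, counted by `λ_an` exactly as in `stub_lambdaCount_offLocus`.
[cite: GreenbergVatsal2000, p. 2–3, (1)–(2)] [cite: MazurTateTeitelbaum1986Invent, §I.15] -/
theorem analyticMuLE_zero_and_exists_analyticLambdaEq_of_unitCoeffAt {m : ℕ}
    (h : UnitCoeffAt W p m) :
    X2.AnalyticMuLE W p 0 ∧ ∃ n : ℕ, X2.AnalyticLambdaEq W p n ∧
      (¬ W.HasSplitMultiplicativeReductionAtPrime p → n ≤ m) ∧
      (W.HasSplitMultiplicativeReductionAtPrime p → n ≤ m + 1) := by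
  constructor
  · intro N _ f hf ϖ hϖ L hLs hLn
    obtain ⟨hns, hs⟩ := h f hf ϖ hϖ
    by_cases hsplit : W.HasSplitMultiplicativeReductionAtPrime p
    · have hm1 : ‖PowerSeries.coeff (m + 1) (PowerSeries.C ((ϖ : ℚ) : ℚ_[p]) * L)‖ = 1 :=
        hs hsplit L (hLs hsplit)
      have hμ : X2.AnalyticMuLE W p 0 := analyticMuLE_zero_of_norm_coeff_eq_one hf hϖ hLs hLn hm1
      exact hμ f hf ϖ hϖ L hLs hLn
    · have hm0 : ‖PowerSeries.coeff m (PowerSeries.C ((ϖ : ℚ) : ℚ_[p]) * L)‖ = 1 :=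
        hns hsplit L (hLn hsplit)
      have hμ : X2.AnalyticMuLE W p 0 := analyticMuLE_zero_of_norm_coeff_eq_one hf hϖ hLs hLn hm0
      exact hμ f hf ϖ hϖ L hLs hLn
  · by_cases hex : ∃ (N : ℕ) (_ : NeZero N) (f : CuspForm (Gamma0 N) 2) (ϖ : ℚ)
        (L : PowerSeries ℚ_[p]), IsNewformOf W f ∧ (ϖ : ℝ) * W.realPeriodRat = plusPeriod f ∧
        (W.HasSplitMultiplicativeReductionAtPrime p → IsSplitMultPAdicLFunctionOf f p L) ∧
        (¬ W.HasSplitMultiplicativeReductionAtPrime p → IsMultPAdicLFunctionOf f p (-1) L)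
    · obtain ⟨N, _, f, ϖ, L, hf, hϖ, hLs, hLn⟩ := hex
      obtain ⟨hns, hs⟩ := h f hf ϖ hϖ
      by_cases hsplit : W.HasSplitMultiplicativeReductionAtPrime p
      · obtain ⟨n, hle, hn⟩ :=
          exists_analyticLambdaEq_le_of_norm_coeff_eq_one hf hϖ hLs hLn (hs hsplit L (hLs hsplit))
        exact ⟨n, hn, fun hns' ↦ absurd hsplit hns', fun _ ↦ hle⟩
      · obtain ⟨n, hle, hn⟩ :=
          exists_analyticLambdaEq_le_of_norm_coeff_eq_one hf hϖ hLs hLn (hns hsplit L (hLn hsplit))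
        exact ⟨n, hn, fun _ ↦ hle, fun hs' ↦ absurd hs' hsplit⟩
    · refine ⟨0, ?_, fun _ ↦ Nat.zero_le _, fun _ ↦ Nat.zero_le _⟩
      intro N _ f hf ϖ hϖ L hLs hLn G hG
      exact absurd ⟨N, inferInstance, f, ϖ, L, hf, hϖ, hLs, hLn⟩ hex

omit [W.IsElliptic] [W.IsGloballyMinimal] [NeZero N] in
/-- The twisted interpolation clause of THE multiplicative MTT function, read through the dichotomy:
`α = 1` at a split, `α = −1` at a non-split prime; in both cases `‖α⁻¹ ^ k‖ = 1`. [cite: MazurTateTeitelbaum1986Invent, §I.14] -/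
theorem exists_interpolation_of_dichotomy
    (hLs : W.HasSplitMultiplicativeReductionAtPrime p → IsSplitMultPAdicLFunctionOf f p L)
    (hLn : ¬ W.HasSplitMultiplicativeReductionAtPrime p → IsMultPAdicLFunctionOf f p (-1) L) :
    ∃ α : ℚ_[p], (∀ k : ℕ, ‖algebraMap ℚ_[p] ℂ_[p] (α⁻¹ ^ k)‖ = 1) ∧
      ∀ (m : ℕ), 0 < m → ∀ χ : DirichletCharacter ℂ_[p] (p ^ m), χ.IsPrimitive → χ.Even →
        (∃ j : ℕ, orderOf χ = p ^ j) →
          HasSum (fun k : ℕ ↦ algebraMap ℚ_[p] ℂ_[p] (PowerSeries.coeff k L) *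
              (χ (cyclotomicGenerator p : ZMod (p ^ m)) - 1) ^ k)
            (algebraMap ℚ_[p] ℂ_[p] (α⁻¹ ^ m) * ratTwistedSymbolSum f χ) := by
  by_cases hsplit : W.HasSplitMultiplicativeReductionAtPrime p
  · exact ⟨1, fun k ↦ by simp, (hLs hsplit).2.2⟩
  · exact ⟨-1, fun k ↦ by simp, (hLn hsplit).2.2⟩

/-- **ONE BIRCH SUM certifies `μ_an = 0` AND `λ_an`.** For one datum `(f, ϖ, L)` with an integral model
`G` (`ι G = ϖ·L`; at a reducible multiplicative odd `p` Wuthrich 2014 Thm. 16 supplies it, g0's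
`exists_data`) and ONE primitive even `p`-power-order `χ` of conductor `p^{n+1+e₀}` with values in
`ℂ_p`: if `|ϖ·∑_a χ(a)[a/p^{n+1+e₀}]⁺_f|^{φ(pⁿ⁺¹)} = p^{−V}` with `V < φ(pⁿ⁺¹)`, then
`X2.AnalyticMuLE W p 0 ∧ X2.AnalyticLambdaEq W p V`. (The Birch sum is `τ(χ̄)·L(E, χ̄, 1)/Ω_E` up to
the unit `α^{-(n+1+e₀)} = ±1`: ONE twisted special value of the layer `n + 1` decides both analytic
inputs of the stub when `λ_an < φ(pⁿ⁺¹)`; at `p = 3`, `n = 0`: `λ_an ∈ {0, 1}` from one value at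
conductor `9`; `n = 1`: `λ_an ≤ 5` from one value at conductor `27`.) [cite: MazurTateTeitelbaum1986Invent, §I.13–I.14]
[cite: Washington1997, §7.1–7.2 and Thm. 7.3] -/
theorem analyticMuLE_zero_and_analyticLambdaEq_of_norm_twist_pow_eq (hf : IsNewformOf W f)
    (hϖ : (ϖ : ℝ) * W.realPeriodRat = plusPeriod f)
    (hLs : W.HasSplitMultiplicativeReductionAtPrime p → IsSplitMultPAdicLFunctionOf f p L)
    (hLn : ¬ W.HasSplitMultiplicativeReductionAtPrime p → IsMultPAdicLFunctionOf f p (-1) L)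
    {G : IwasawaAlgebra p} (hG : iwasawaToPowerSeries p G = PowerSeries.C ((ϖ : ℚ) : ℚ_[p]) * L)
    {n : ℕ} (χ : DirichletCharacter ℂ_[p] (p ^ (n + 1 + cyclotomicExponent p)))
    (hχ : χ.IsPrimitive) (heven : χ.Even) (hord : ∃ j : ℕ, orderOf χ = p ^ j) {V : ℕ}
    (hV : V < Nat.totient (p ^ (n + 1)))
    (h : ‖algebraMap ℚ_[p] ℂ_[p] ((ϖ : ℚ) : ℚ_[p]) * ratTwistedSymbolSum f χ‖ ^
      Nat.totient (p ^ (n + 1)) = ((p : ℝ)⁻¹) ^ V) :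
    X2.AnalyticMuLE W p 0 ∧ X2.AnalyticLambdaEq W p V := by
  obtain ⟨α, hα, hI⟩ := exists_interpolation_of_dichotomy (W := W) hLs hLn
  -- insert the unit `α^{-(n+1+e₀)}`
  have hnorm : ‖algebraMap ℚ_[p] ℂ_[p] ((ϖ : ℚ) : ℚ_[p]) *
      (algebraMap ℚ_[p] ℂ_[p] (α⁻¹ ^ (n + 1 + cyclotomicExponent p)) * ratTwistedSymbolSum f χ)‖ =
      ‖algebraMap ℚ_[p] ℂ_[p] ((ϖ : ℚ) : ℚ_[p]) * ratTwistedSymbolSum f χ‖ := by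
    rw [norm_mul, norm_mul, hα, one_mul, norm_mul]
  have h' : ‖algebraMap ℚ_[p] ℂ_[p] ((ϖ : ℚ) : ℚ_[p]) *
      (algebraMap ℚ_[p] ℂ_[p] (α⁻¹ ^ (n + 1 + cyclotomicExponent p)) * ratTwistedSymbolSum f χ)‖ ^
        Nat.totient (p ^ (n + 1)) = ((p : ℝ)⁻¹) ^ V := by rw [hnorm, h]
  -- `G ≠ 0`: otherwise the value vanishes, but `p^{-V} ≠ 0`
  have hG0 : G ≠ 0 := by
    intro hG0
    have hsum := hasSum_integralModel_eq_ratTwistedSymbolSum hI hG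
      (by omega : 0 < n + 1 + cyclotomicExponent p) χ hχ heven hord
    rw [hG0] at hsum
    have hzero : algebraMap ℚ_[p] ℂ_[p] ((ϖ : ℚ) : ℚ_[p]) *
        (algebraMap ℚ_[p] ℂ_[p] (α⁻¹ ^ (n + 1 + cyclotomicExponent p)) *
          ratTwistedSymbolSum f χ) = 0 := by
      refine hsum.unique ?_
      simp
    rw [hzero, norm_zero, zero_pow (Nat.totient_pos.mpr (pow_pos (Fact.out : p.Prime).pos _)).ne']
      at h'
    have hpos : (0 : ℝ) < ((p : ℝ)⁻¹) ^ V := pow_pos (inv_pos.mpr (by exact_mod_cast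
      (Fact.out : p.Prime).pos)) V
    exact absurd h' hpos.ne
  obtain ⟨hμ, hlam⟩ := mu_eq_zero_and_lam_eq_of_norm_twist_pow_eq hI hG hG0 χ hχ heven hord hV h'
  -- `μ(G) = 0`: some coefficient of `G`, i.e. of `ϖ·L`, is a unit
  have hunit : HasUnitContent G := hasUnitContent_of_mu_eq_zero hG0 hμ
  obtain ⟨k, hk⟩ := (hasUnitContent_iff_exists_norm_eq_one G).mp hunit
  rw [norm_coeff_eq_of_iota_eq hG] at hk
  refine ⟨analyticMuLE_zero_of_norm_coeff_eq_one hf hϖ hLs hLn hk,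
    (analyticLambdaEq_iff_of_datum hf hϖ hLs hLn V).mpr fun G' hG' ↦ ?_⟩
  rw [iwasawaToPowerSeries_injective p (hG'.trans hG.symm), hlam]

/-- **A VANISHING BIRCH SUM of conductor `p^{n+1+e₀}` forces `λ_an ≥ φ(pⁿ⁺¹)`**: for one datum with an
integral model `G` and a primitive even `p`-power-order `χ` of conductor `p^{n+1+e₀}` with
`∑_a χ(a)[a/p^{n+1+e₀}]⁺_f = 0` (equivalently `L(E, χ̄, 1) = 0`, Birch's formula), every certified
`X2.AnalyticLambdaEq W p n'` has `φ(pⁿ⁺¹) ≤ n'` — `G` vanishes at `χ(γ) − 1`, a point `ζ − 1` with `ζ`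
of order `pⁿ⁺¹`, so the `pⁿ⁺¹`-th cyclotomic polynomial in `1 + T` divides `G`
(`Iwasawa.totient_le_lam_of_hasSum_zero`). Kernel face of HOME/lam-a-g2/lam-a-MEMO-2.md §4b: each
torsion-point zero of `L_p(E₀, T)` (numerically a Mordell–Weil rank jump of `E₀` in `ℚ_{n+1}`;
`267@3`, `186@5`, `435@3`) raises the `k` that stub 4 must supply by `φ(pⁿ⁺¹)`.
[cite: MazurTateTeitelbaum1986Invent, §I.13–I.14] [cite: Washington1997, §7.1–7.2] -/
theorem totient_le_of_analyticLambdaEq_of_twist_eq_zero (hf : IsNewformOf W f)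
    (hϖ : (ϖ : ℝ) * W.realPeriodRat = plusPeriod f)
    (hLs : W.HasSplitMultiplicativeReductionAtPrime p → IsSplitMultPAdicLFunctionOf f p L)
    (hLn : ¬ W.HasSplitMultiplicativeReductionAtPrime p → IsMultPAdicLFunctionOf f p (-1) L)
    {G : IwasawaAlgebra p} (hG : iwasawaToPowerSeries p G = PowerSeries.C ((ϖ : ℚ) : ℚ_[p]) * L)
    (hG0 : G ≠ 0) {n : ℕ} (χ : DirichletCharacter ℂ_[p] (p ^ (n + 1 + cyclotomicExponent p)))
    (hχ : χ.IsPrimitive) (heven : χ.Even) (hord : ∃ j : ℕ, orderOf χ = p ^ j)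
    (hzero : ratTwistedSymbolSum f χ = 0) {n' : ℕ} (hn' : X2.AnalyticLambdaEq W p n') :
    Nat.totient (p ^ (n + 1)) ≤ n' := by
  obtain ⟨α, -, hI⟩ := exists_interpolation_of_dichotomy (W := W) hLs hLn
  have hsum := hasSum_integralModel_eq_ratTwistedSymbolSum hI hG
    (by omega : 0 < n + 1 + cyclotomicExponent p) χ hχ heven hord
  rw [hzero, mul_zero, mul_zero] at hsum
  rw [← (analyticLambdaEq_iff_of_datum hf hϖ hLs hLn n').mp hn' G hG]
  exact totient_le_lam_of_hasSum_zero hG0 (isPrimitiveRoot_apply_cyclotomicGenerator χ hχ heven hord)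
    hsum

end Certificates

end Summit.BirchSwinnertonDyer.BirchSwinnertonDyer.Theorems.EisensteinPrimesX2AnalyticLambdaCertificate

end
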